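import Literature.AlgebraicGeometry.AbelianSchemes.AbelianSchemeHomDescentEquivariant
import Literature.AlgebraicGeometry.AbelianSchemes.AbelianSchemeDualIsogenyComp
import Literature.AlgebraicGeometry.AbelianSchemes.AbelianSchemeOverMulNFiniteFlat
import HarnessLib

/-!
# The recognition isomorphism is POLARISED: `ψ^*λ_C = φ^*λ_B ⟹ e^*λ_B = λ_C` ([MumfordAV1970] §7 Thm. 4, §15 Thm. 1, §23)

Topic `Literature/AlgebraicGeometry/AbelianSchemes`, namespace `Literature.AlgebraicGeometry.AbelianSchemes.AbelianSchemeOver` (THEOREMS ONLY; no definition,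
no named fact, no `sorry`, no `instance`, no notation; ANY base scheme `S`).  Cell `hodgecm-mathlib`, F0/P6 «MOD», organ **ST-2b (λ-clause)** of desk
F0P6a-plan (g0) (16:06:53Z «(λ) ST-2b polarization clause = WANTED after (b) — D4՚s λ-exact quotient and FROB₀՚s `A^{(q)} ≅ A′ ⊗ 𝔞⁻¹`-bookkeeping need the
POLARISED recognition»), over ★ ST-2b (core) `AbelianSchemeHomDescentEquivariant` (p845176: `cancel_left_of_flat_surjective`, the recognition iso), ★
`AbelianSchemeDualIsogenyComp` (`dualIsogenyOver_comp`), ★ `AbelianSchemeOverMulNFiniteFlat` (`[M]_C` is an fppf cover); `--supports stmt-HodgeConjecture-24832`,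
count-neutral.  HC_CM is proved only modulo the 2 remaining named inputs (hLiu418, h413) until rung 0 closes; this file discharges none of them.

## Mathematics

(§1) RIGHT CANCELLATION OF ISOGENIES for homomorphisms out of an abelian scheme: if `χ : G → G′` admits `χ′` with `χ ≫ χ′ = [M]_G` (`M ≠ 0`) then
`x ≫ χ = y ≫ χ ⟹ x = y` for HOMOMORPHISMS `x, y : C → G` from an abelian scheme `C` — post-compose with `χ′`, commute `[M]` past the homomorphisms
(`x ≫ [M]_G = [M]_C ≫ x`) and cancel the fppf cover `[M]_C` on the left (★ `cancel_left_of_flat_surjective`, ★ `flat∕surjective∕isFinite_pow_id_left_of_ne_zero`);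
no rigidity ∕ reducedness hypothesis.  (§2) POLARISED RECOGNITION: `ψ : A → C` an fppf homomorphism, `e : C ≅ B` with `ψ ≫ e = φ` (★ recognition), dual pairs
`D_A, D_B, D_C`, homomorphisms `λ_B : B → B̂`, `λ_C : C → Ĉ`; if the pull-backs to `A` agree, `ψ ≫ λ_C ≫ ψ^∨ = φ ≫ λ_B ≫ φ^∨`, and `ψ^∨` has a quasi-inverse
(`ψ^∨ ≫ χ′ = [M]`, e.g. from `ψ′ ≫ ψ = [M]_C` by ★ `dualIsogenyOver_comp` + ★ `dualIsogenyOver_mulN`), then **`e ≫ λ_B ≫ e^∨ = λ_C`** (`φ^∨ = e^∨ ≫ ψ^∨` by ★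
`dualIsogenyOver_comp`; cancel `ψ` on the left and `ψ^∨` on the right): two polarised isogeny quotients of `(A, λ)` with the same kernel and the same
pull-back of the polarisation are isomorphic AS POLARISED abelian schemes ([MumfordAV1970] §23 «the polarisation descends uniquely»).

## Contents

* §1 **`cancel_right_of_comp_eq_pow_id`** (right cancellation of a quasi-invertible homomorphism against homomorphisms out of an abelian scheme),
  `comp_pow_id_eq_pow_id_comp` (`x ≫ [M] = [M] ≫ x`).
* §2 `dualIsogenyOver_recognition` (`φ^∨ = e^∨ ≫ ψ^∨`), **`comp_lam_comp_dualIsogenyOver_eq_of_pullback_eq`** (`e ≫ λ_B ≫ e^∨ = λ_C`).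

## References
* [MumfordAV1970] D. Mumford, *Abelian Varieties* (1970), §7 Thm. 4 (p. 72), §15 Thm. 1 (p. 143), §23 (p. 231) (descent of polarisations along isogenies).
* [MumfordFogartyKirwan1994] GIT (3rd ed.), Ch. 6 §2 Def. 6.3, Prop. 6.10 (polarisations of abelian schemes).
* [GortzWedhorn2023] U. Görtz, T. Wedhorn, *Algebraic Geometry II* (2023), Prop. 27.186, Cor. 27.177 (1) (`[M]` finite flat surjective).
* Tree: ★ `AbelianSchemeHomDescentEquivariant`, ★ `AbelianSchemeDualIsogeny(Comp)`, ★ `AbelianSchemeOverMulNFiniteFlat`.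
-/

noncomputable section

universe u

open CategoryTheory CategoryTheory.Limits AlgebraicGeometry MonoidalCategory CartesianMonoidalCategory
open scoped MonObj

namespace Literature.AlgebraicGeometry.AbelianSchemes

namespace AbelianSchemeOver

variable {S : Scheme.{u}}

/-! ## §1 Right cancellation of quasi-invertible homomorphisms against homomorphisms out of an abelian scheme -/

section CancelRight

variable (C : AbelianSchemeOver S) {G G' : Over S} [GrpObj G]

/-- A homomorphism commutes with multiplication by `M`: `x ≫ [M]_G = [M]_C ≫ x`. [cite: MumfordFogartyKirwan1994, Ch. 6 §1 Corollary 6.4 (p. 117)] -/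
theorem comp_pow_id_eq_pow_id_comp (x : C.X ⟶ G) [IsMonHom x] (M : ℕ) :
    x ≫ (𝟙 G) ^ M = ((𝟙 C.X) ^ M) ≫ x := by
  rw [MonObj.comp_pow, MonObj.pow_comp, Category.comp_id, Category.id_comp]

/-- **RIGHT CANCELLATION**: if `χ ≫ χ′ = [M]_G` with `M ≠ 0`, then `x ≫ χ = y ≫ χ → x = y` for homomorphisms `x y : C → G` out of an abelian scheme
(`[M]_C` is an fppf cover, hence an epimorphism). [cite: MumfordAV1970, §7 Thm. 4 (p. 72)] [cite: GortzWedhorn2023, Prop. 27.186 and Cor. 27.177 (1)] -/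
theorem cancel_right_of_comp_eq_pow_id (χ : G ⟶ G') (χ' : G' ⟶ G) {M : ℕ} (hM : M ≠ 0) (hχ : χ ≫ χ' = (𝟙 G) ^ M)
    (x y : C.X ⟶ G) [IsMonHom x] [IsMonHom y] (h : x ≫ χ = y ≫ χ) : x = y := by
  have h1 : x ≫ (𝟙 G) ^ M = y ≫ (𝟙 G) ^ M := by rw [← hχ, ← Category.assoc, h, Category.assoc]
  rw [C.comp_pow_id_eq_pow_id_comp x M, C.comp_pow_id_eq_pow_id_comp y M] at h1
  haveI := C.flat_pow_id_left_of_ne_zero hM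
  haveI := C.surjective_pow_id_left_of_ne_zero hM
  haveI := C.isFinite_pow_id_left_of_ne_zero hM
  exact C.cancel_left_of_flat_surjective ((𝟙 C.X) ^ M) h1

end CancelRight

/-! ## §2 The recognition isomorphism respects polarisations -/

section Polarized

variable {A B C : AbelianSchemeOver S} (ψ : A.X ⟶ C.X) [IsMonHom ψ] (DA : A.DualPair) (DB : B.DualPair) (DC : C.DualPair)
  (e : C.X ≅ B.X) [IsMonHom e.hom]

/-- `φ^∨ = e^∨ ≫ ψ^∨` for `φ = ψ ≫ e` (★ `dualIsogenyOver_comp`). [cite: MumfordAV1970, §15 Thm. 1 (p. 143)] -/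
theorem dualIsogenyOver_recognition :
    DualPair.dualIsogenyOver (ψ ≫ e.hom) DA DB = DualPair.dualIsogenyOver e.hom DC DB ≫ DualPair.dualIsogenyOver ψ DA DC :=
  DualPair.dualIsogenyOver_comp ψ e.hom DA DC DB

/-- **POLARISED RECOGNITION** ([MumfordAV1970] §23: the polarisation of an isogeny quotient is determined by its pull-back): let `ψ : A → C` be an fppf
homomorphism, `e : C ≅ B` a homomorphism with `φ := ψ ≫ e`, `λ_B : B → B̂`, `λ_C : C → Ĉ` homomorphisms whose PULL-BACKS TO `A` AGREE,
`ψ ≫ λ_C ≫ ψ^∨ = φ ≫ λ_B ≫ φ^∨`, and suppose `ψ^∨ ≫ χ′ = [M]_{Ĉ}` for some `χ′`, `M ≠ 0` (a quasi-inverse of the dual isogeny).  Then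
**`e ≫ λ_B ≫ e^∨ = λ_C`**: `e` is an isomorphism of POLARISED abelian schemes. [cite: MumfordAV1970, §23 (p. 231)] [cite: MumfordAV1970, §15 Thm. 1 (p. 143)]
[cite: MumfordFogartyKirwan1994, Ch. 6 §2 Definition 6.3 (p. 120)] -/
theorem comp_lam_comp_dualIsogenyOver_eq_of_pullback_eq [Flat ψ.left] [Surjective ψ.left] [QuasiCompact ψ.left]
    (lamB : B.X ⟶ DB.hat.X) (lamC : C.X ⟶ DC.hat.X) [IsMonHom lamB] [IsMonHom lamC]
    [IsMonHom (DualPair.dualIsogenyOver e.hom DC DB)]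
    (χ' : DA.hat.X ⟶ DC.hat.X) {M : ℕ} (hM : M ≠ 0) (hχ : DualPair.dualIsogenyOver ψ DA DC ≫ χ' = (𝟙 DC.hat.X) ^ M)
    (hpull : ψ ≫ lamC ≫ DualPair.dualIsogenyOver ψ DA DC = (ψ ≫ e.hom) ≫ lamB ≫ DualPair.dualIsogenyOver (ψ ≫ e.hom) DA DB) :
    e.hom ≫ lamB ≫ DualPair.dualIsogenyOver e.hom DC DB = lamC := by
  rw [dualIsogenyOver_recognition ψ DA DB DC e, Category.assoc] at hpull
  -- cancel `ψ` on the left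
  have h1 : lamC ≫ DualPair.dualIsogenyOver ψ DA DC =
      (e.hom ≫ lamB ≫ DualPair.dualIsogenyOver e.hom DC DB) ≫ DualPair.dualIsogenyOver ψ DA DC := by
    apply A.cancel_left_of_flat_surjective ψ
    rw [hpull]
    simp only [Category.assoc]
  -- cancel `ψ^∨` on the right
  exact (C.cancel_right_of_comp_eq_pow_id (DualPair.dualIsogenyOver ψ DA DC) χ' hM hχ lamC
    (e.hom ≫ lamB ≫ DualPair.dualIsogenyOver e.hom DC DB) h1).symm

end Polarized

end AbelianSchemeOver

end Literature.AlgebraicGeometry.AbelianSchemes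

end
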